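import Literature.IUT.HodgeTheaters.ProfiniteCompletionLemma27v
import Literature.IUT.HodgeTheaters.ProfiniteCompletionFunctorial
import Literature.IUT.HodgeTheaters.ProfiniteCompletionNormalizers
import HarnessLib

/-!
# [IUTchI] §2, proof of Theorem 2.6: the two printed uses of Lemma 2.7 (v) —
# `N_Ĝ(Ĥ_G) = Ĥ_G` (p. 57 l. 4–5) and `N_Ĝ(H_x) = Ĥ_x`, `N_Ĝ(H_y) = Ĥ_y` (p. 57 l. 17–19) —
# for free AND orientable-surface `G`, unconditionally

Mochizuki, *Inter-universal Teichmüller theory I: construction of Hodge theaters*, kurims manuscript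
(May 2020), §2, proof of Theorem 2.6, p. 57 [cite: Mochizuki2012, Thm 2.6 p.57] (D-0012 claim key;
the series' status is DISPUTED — the content of this file is plain profinite group theory and takes no
side).  PROOF-ONLY companion (no definitions) of `DiscreteProfiniteConjugates.lean` (abc-iut-L5-t1:
the named statement `FreeOrSurface.zHatQuotientNormallyTerminal` = Lemma 2.7 (v)) and of
`ProfiniteCompletionNormalizers.lean` (abc-iut-L5-d2 lineage: the FREE case
`ProfiniteCompletion.normalizer_closure_zpowers_eq_of_isFreeGroup`, obtained there through conjugacy
separability of free groups).

Printed step (sub-DAG `plan/L5/SUBDAG-IUTchI-Thm26.md`, rows T26-L03 / T26-L08): in the proof of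
Theorem 2.6, after "replacing `G` by an appropriate finite index subgroup of `G`, we may assume that
the natural composite homomorphism `H_G ↪ G ↠ G^{ab}` is a split injection [Lemma 2.7 (ii)].  Then by
Lemma 2.7, (v), it follows that `N_Ĝ(H_G) = Ĥ_G`" (p. 57 l. 1–5), and again "by Lemma 2.7, (v), we
conclude that `N_Ĝ(H_x) = Ĥ_x`, `N_Ĝ(H_y) = Ĥ_y`" (p. 57 l. 17–19).  Here `H_G = ⟨g⟩` is infinite cyclic
and "split injection" means: some homomorphism `φ : G → ℤ` maps `g` to a generator.

What is proved (for ANY `G` that is free of finite rank OR an orientable surface group, using the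
tree's theorem `FreeOrSurface.zHatQuotientNormallyTerminal_holds` = Lemma 2.7 (v) AS TYPED, now
unconditional, and NO conjugacy separability):

* `exists_zHat_hom_range_eq_closure_zpowers` — for any group `G` and `g ∈ G`, the continuous
  homomorphism `Ψ : ℤ̂ → Ĝ` completing `n ↦ gⁿ` has range EXACTLY `T̂_g := closure (η ⟨g⟩)` (so `T̂_g`
  is procyclic);
* `commute_of_mem_closure_zpowers` — anything commuting with `η g` commutes with all of `T̂_g`;
* `FreeOrSurface.normalizer_closure_zpowers_eq` — **for `G` free of finite rank or an orientable
  surface group, `g ∈ G` and `φ : G → ℤ` with `φ g = 1`: `N_Ĝ(T̂_g) = T̂_g` and `C_Ĝ(η g) = T̂_g`.**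
  Route: `Φ :=` the completion `Ĝ → ℤ̂` of `φ`; `Φ ∘ Ψ = id_{ℤ̂}` (both continuous, agree on the dense
  `η(ℤ)`), so `Φ` is a continuous surjection inducing a bijection `T̂_g = Ψ(ℤ̂) ⥲ ℤ̂` — exactly the
  hypothesis of Lemma 2.7 (v) — whence `N_Ĝ(T̂_g) = T̂_g`; the centralizer clause because `T̂_g` is
  abelian and `C_Ĝ(η g)` centralizes, hence normalizes, `T̂_g`.

This is the orientable-surface twin of the free-group statement already in the tree; the surface case
was previously reachable only through the hereditary-conjugacy-separability route
(`ProfiniteCompletionCentralizersCS`, conditional on `SurfaceGroupConjugacySeparable`, F-2732).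
Theorems only; no statement of the tree is restated; typed ≠ endorsed.
-/

namespace Literature.IUT.HodgeTheaters.ProfiniteCompletion

open CategoryTheory ProfiniteGrp ProfiniteGrp.ProfiniteCompletion Topology Pointwise

universe u

variable {G : Type u} [Group G]

/-! ### `T̂_g = closure (η ⟨g⟩)` is the image of `ℤ̂` -/

/-- **`T̂_g` is procyclic, explicitly**: for any group `G` and `g ∈ G`, the continuous homomorphism
`Ψ : ℤ̂ → Ĝ` completing `ℤ → G`, `n ↦ gⁿ` satisfies `Ψ (η n) = η (gⁿ)` and has range exactly
`T̂_g = closure (η ⟨g⟩)` (the range is compact, hence closed, and contains `η ⟨g⟩` densely).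
[cite: Mochizuki2012, Thm 2.6 p.57] -/
theorem exists_zHat_hom_range_eq_closure_zpowers (g : G) :
    ∃ Ψ : ZHat →* profiniteCompletion G, Continuous Ψ ∧
      (∀ n : ℤ, Ψ (toCompletion (Multiplicative ℤ) (Multiplicative.ofAdd n)) =
        toCompletion G (g ^ n)) ∧
      Set.range Ψ = closure (toCompletion G '' (Subgroup.zpowers g : Set G)) := by
  obtain ⟨Ψ, hΨc, hΨη⟩ := exists_map_comp_toCompletion (zpowersHom G g)
  have hΨn : ∀ n : ℤ, Ψ (toCompletion (Multiplicative ℤ) (Multiplicative.ofAdd n)) =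
      toCompletion G (g ^ n) := by
    intro n
    rw [hΨη, zpowersHom_apply, toAdd_ofAdd]
  refine ⟨Ψ, hΨc, hΨn, Set.Subset.antisymm ?_ ?_⟩
  · -- `Ψ(ℤ̂) ⊆ closure (η ⟨g⟩)`: `Ψ` maps the dense `η(ℤ)` into `η ⟨g⟩`
    rintro _ ⟨z, rfl⟩
    refine apply_mem_closure_of_forall hΨc (fun a => ?_) z
    refine ⟨g ^ (Multiplicative.toAdd a), ⟨Multiplicative.toAdd a, rfl⟩, ?_⟩
    rw [← hΨn, ofAdd_toAdd]
  · -- `closure (η ⟨g⟩) ⊆ Ψ(ℤ̂)`: the range is closed and contains `η ⟨g⟩`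
    refine closure_minimal ?_ (isCompact_range hΨc).isClosed
    rintro _ ⟨x, ⟨n, rfl⟩, rfl⟩
    exact ⟨toCompletion (Multiplicative ℤ) (Multiplicative.ofAdd n), by
      rw [hΨn]⟩

/-- Anything in `Ĝ` commuting with `η g` commutes with every element of `T̂_g = closure (η ⟨g⟩)`
(the commutant of an element is closed). [cite: Mochizuki2012, Thm 2.6 p.57] -/
theorem commute_of_mem_closure_zpowers (g : G) {γ : profiniteCompletion G}
    (hγ : Commute (toCompletion G g) γ) {t : profiniteCompletion G}
    (ht : t ∈ closure (toCompletion G '' (Subgroup.zpowers g : Set G))) : Commute t γ := by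
  have hclosed : IsClosed {s : profiniteCompletion G | s * γ = γ * s} :=
    isClosed_eq (continuous_id.mul continuous_const) (continuous_const.mul continuous_id)
  have hsub : toCompletion G '' (Subgroup.zpowers g : Set G) ⊆
      {s : profiniteCompletion G | s * γ = γ * s} := by
    rintro _ ⟨x, ⟨n, rfl⟩, rfl⟩
    change toCompletion G (g ^ n) * γ = γ * toCompletion G (g ^ n)
    rw [map_zpow]
    exact (hγ.zpow_left n).eq
  exact closure_minimal hsub hclosed ht

/-! ### The printed uses of Lemma 2.7 (v) in the proof of Theorem 2.6 -/

/-- **[IUTchI] proof of Theorem 2.6, p. 57 l. 4–5 and l. 17–19 ("by Lemma 2.7, (v), `N_Ĝ(H_G) = Ĥ_G`";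
"`N_Ĝ(H_x) = Ĥ_x`, `N_Ĝ(H_y) = Ĥ_y`") — free AND orientable-surface case, unconditionally.**  Let `G` be
free of finite rank or an orientable surface group, `g ∈ G`, and `φ : G → ℤ` a homomorphism with
`φ g = 1` (i.e. `⟨g⟩ ↪ G ↠ G^{ab}` is a split injection).  Then for `T̂_g := closure (η ⟨g⟩) ⊆ Ĝ`:
`N_Ĝ(T̂_g) = T̂_g` and `C_Ĝ(η g) = T̂_g`.  Derived from Lemma 2.7 (v)
(`FreeOrSurface.zHatQuotientNormallyTerminal_holds`) applied to `T̂ := T̂_g` and the completion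
`Φ : Ĝ ↠ ℤ̂` of `φ`, which restricts to a bijection `T̂_g ⥲ ℤ̂` because `Φ ∘ Ψ = id_{ℤ̂}` for the map `Ψ`
of `exists_zHat_hom_range_eq_closure_zpowers`. [cite: Mochizuki2012, Thm 2.6 p.57] -/
theorem FreeOrSurface.normalizer_closure_zpowers_eq (hG : IsFreeOrSurface G)
    (g : G) (φ : G →* Multiplicative ℤ) (hφ : φ g = Multiplicative.ofAdd 1) :
    (Subgroup.normalizer (closure (toCompletion G '' (Subgroup.zpowers g : Set G))) :
        Set (profiniteCompletion G)) = closure (toCompletion G '' (Subgroup.zpowers g : Set G)) ∧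
    (Subgroup.centralizer ({toCompletion G g} : Set (profiniteCompletion G)) : Set _) =
        closure (toCompletion G '' (Subgroup.zpowers g : Set G)) := by
  -- the closed subgroup `T̂_g`
  set T : Subgroup (profiniteCompletion G) :=
    ((Subgroup.zpowers g).map (toCompletion G)).topologicalClosure with hTdef
  have hT : (T : Set (profiniteCompletion G)) =
      closure (toCompletion G '' (Subgroup.zpowers g : Set G)) := by
    rw [hTdef, Subgroup.topologicalClosure_coe, Subgroup.coe_map]
  have hTclosed : IsClosed (T : Set (profiniteCompletion G)) := by
    rw [hT]; exact isClosed_closure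
  -- `Φ : Ĝ → ℤ̂` completing `φ`, and `Ψ : ℤ̂ → Ĝ` completing `n ↦ gⁿ`
  obtain ⟨Φ, hΦc, hΦη⟩ := exists_map_comp_toCompletion φ
  obtain ⟨Ψ, hΨc, hΨn, hΨrange⟩ := exists_zHat_hom_range_eq_closure_zpowers g
  -- `Φ ∘ Ψ = id` on `ℤ̂`
  have hΦΨ : ∀ z : ZHat, Φ (Ψ z) = z := by
    have key : Φ.comp Ψ = MonoidHom.id _ := by
      refine eq_of_forall_apply_toCompletion_eq (hΦc.comp hΨc) continuous_id fun a => ?_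
      rw [MonoidHom.comp_apply, MonoidHom.id_apply, ← ofAdd_toAdd a, hΨn, hΦη, map_zpow, hφ,
        ← ofAdd_zsmul, smul_eq_mul, mul_one]
    intro z
    exact DFunLike.congr_fun key z
  -- hence `Φ` is surjective and bijective on `T̂_g = Ψ(ℤ̂)`
  have hΦsurj : Function.Surjective Φ := fun z => ⟨Ψ z, hΦΨ z⟩
  have hmemT : ∀ z : ZHat, Ψ z ∈ T := fun z => by
    rw [← SetLike.mem_coe, hT, ← hΨrange]; exact ⟨z, rfl⟩
  have hTrange : ∀ t ∈ T, ∃ z : ZHat, Ψ z = t := fun t ht => by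
    have ht' : t ∈ (T : Set (profiniteCompletion G)) := ht
    rw [hT, ← hΨrange] at ht'
    exact ht'
  have hbij : Function.Bijective (Φ.comp T.subtype) := by
    constructor
    · rintro ⟨t, ht⟩ ⟨t', ht'⟩ h
      obtain ⟨z, rfl⟩ := hTrange t ht
      obtain ⟨z', rfl⟩ := hTrange t' ht'
      have h' : Φ (Ψ z) = Φ (Ψ z') := h
      rw [hΦΨ, hΦΨ] at h'
      subst h'
      rfl
    · intro z
      exact ⟨⟨Ψ z, hmemT z⟩, hΦΨ z⟩
  -- Lemma 2.7 (v)
  have h27v : Subgroup.normalizer (T : Set (profiniteCompletion G)) = T :=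
    FreeOrSurface.zHatQuotientNormallyTerminal_holds G hG T hTclosed ⟨Φ, hΦc, hΦsurj, hbij⟩
  have hN : (Subgroup.normalizer (closure (toCompletion G '' (Subgroup.zpowers g : Set G))) :
      Set (profiniteCompletion G)) = closure (toCompletion G '' (Subgroup.zpowers g : Set G)) := by
    rw [← hT, h27v]
  refine ⟨hN, Set.Subset.antisymm ?_ ?_⟩
  · -- `C_Ĝ(η g)` centralizes, hence normalizes, `T̂_g`
    rw [← hN]
    intro γ hγ
    rw [SetLike.mem_coe, Subgroup.mem_centralizer_iff] at hγ
    have hc : Commute (toCompletion G g) γ := hγ _ (Set.mem_singleton _)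
    rw [SetLike.mem_coe, Subgroup.mem_set_normalizer_iff]
    intro h
    constructor
    · intro hh
      rwa [← (commute_of_mem_closure_zpowers g hc hh).eq, mul_inv_cancel_right]
    · intro hh
      have hc' : Commute (toCompletion G g) γ⁻¹ := hc.inv_right
      have e : γ⁻¹ * (γ * h * γ⁻¹) * γ⁻¹⁻¹ = h := by group
      rw [← e, ← (commute_of_mem_closure_zpowers g hc' hh).eq, mul_inv_cancel_right]
      exact hh
  · -- `T̂_g` is abelian around `η g`
    intro t ht
    rw [SetLike.mem_coe, Subgroup.mem_centralizer_iff]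
    intro x hx
    rw [Set.mem_singleton_iff] at hx
    subst hx
    exact ((commute_of_mem_closure_zpowers g (Commute.refl _) ht).eq).symm

end Literature.IUT.HodgeTheaters.ProfiniteCompletion
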